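import Summits.QuantumFields.YangMills.Theorems.FiniteSusceptibilityWeakCoupling.Negative.BetaZeroClause
import Literature.Barriers.QuantumFields.AbelianDeconfinementD4

/-!
# `FiniteSusceptibilityWeakCoupling` — negative-side support: which hypotheses are load-bearing

Second support file for crux `stmt-QuantumFields-9442` (`FradkinShenkerFlow.FiniteSusceptibilityWeakCoupling`),
extracted from the standing disprover's work file `Cruxes/FiniteSusceptibilityWeakCoupling/Disproof.lean` §§1–2;
builds on `Negative/BetaZeroClause.lean`.

* `not_isSimpleCompactGroup_of_comm`, `circle_not_isCompactSimpleLieGroup`, `t2Space_of_isCompactSimpleLieGroup` —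
  junk exclusion: abelian groups (the trivial group, `U(1)`, tori) fail the crux's hypothesis, and any group
  passing it is Hausdorff (so, being compact with a faithful representation, a closed subgroup of `U(N)`).
* `nonempty_latticeRep_redundant` — the conjunct `Nonempty (LatticeRep G)` of `IsCompactSimpleLieGroup` is
  implied by the binder `∀ r : LatticeRep G` that follows it (information for provers).
* `susceptibility_clause_trivialRep` — dropping FAITHFULNESS does not produce a counterexample through the
  trivial representation: there the Wilson weight is `1`, the measure is product Haar at every `β`, and the
  clause holds at every `β` (by the `β = 0` bound).
* `false_without_simple_of_u1TorusPlaquetteNonSummable` — dropping SIMPLICITY admits `G = U(1)`, and the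
  weakened statement (written inline) is refuted MODULO the torus/Wilson transcription of Fröhlich–Spencer's theorem that the two-plaquette
  function of the Coulomb phase "cannot have summable fall-off" (CMP 83 (1982) §2.11, printed for the Villain
  action; the Wilson-action Coulomb phase is the open conjecture
  `Literature.Barriers.QuantumFields.AbelianMasslessPhaseD4`).  Physically: the photon is massless, the
  field strength has dimension 2, `Cov(P₀, P_x) ~ |x|⁻⁴`, and `∑_{|x| ≤ S} |x|⁻⁴ ~ log S` in `d = 4` — the
  crux's ABSOLUTE sum diverges while the signed sum stays bounded. [folklore]
-/

noncomputable section

open MeasureTheory ProbabilityTheory Finset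
open Literature.MathematicalPhysics.QuantumFieldTheory hiding ZdEdge
open Literature.MathematicalPhysics.QuantumLattice
open Literature.Probability.LatticeModels hiding configShift configShift_apply

namespace Summit.QuantumFields.YangMills.Theorems.FiniteSusceptibilityWeakCoupling.Negative

/-! ### Junk exclusion -/

/-- An abelian group is not `IsSimpleCompactGroup` (the predicate demands a non-commuting pair): the trivial
group, `U(1)` and every torus are outside the crux. [folklore] -/
theorem not_isSimpleCompactGroup_of_comm {G : Type*} [Group G] [TopologicalSpace G]
    (h : ∀ a b : G, a * b = b * a) : ¬ IsSimpleCompactGroup G :=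
  fun hs => by obtain ⟨a, b, hab⟩ := hs.2.1; exact hab (h a b)

/-- `U(1) = Circle` — the group whose Coulomb phase is the only known mechanism against the conclusion — is
excluded by the crux's hypothesis. [folklore] -/
theorem circle_not_isCompactSimpleLieGroup : ¬ IsCompactSimpleLieGroup Circle :=
  fun h => not_isSimpleCompactGroup_of_comm (fun a b => mul_comm a b) h.1

/-- A group satisfying the crux's hypothesis is Hausdorff (a faithful continuous representation separates
points). [folklore] -/
theorem t2Space_of_isCompactSimpleLieGroup {G : Type*} [Group G] [TopologicalSpace G] [CompactSpace G]
    (h : IsCompactSimpleLieGroup G) : T2Space G := by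
  obtain ⟨r⟩ := h.2
  exact .of_injective_continuous r.injective r.continuous

/-- **Redundancy.** For any property `P` of lattice representations, assuming `IsCompactSimpleLieGroup G`
before `∀ r : LatticeRep G` is the same as assuming `IsSimpleCompactGroup G` only. [folklore] -/
theorem nonempty_latticeRep_redundant {G : Type*} [Group G] [TopologicalSpace G] [CompactSpace G]
    (P : LatticeRep G → Prop) :
    (IsCompactSimpleLieGroup G → ∀ r : LatticeRep G, P r) ↔ (IsSimpleCompactGroup G → ∀ r : LatticeRep G, P r) :=
  ⟨fun h hG r => h ⟨hG, ⟨r⟩⟩ r, fun h hG r => h hG.1 r⟩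

/-! ### Faithfulness: the trivial representation is harmless -/

section TrivialRep

variable {G : Type} [Group G] [TopologicalSpace G] [IsTopologicalGroup G] [CompactSpace G]
  [MeasurableSpace G] [BorelSpace G]

omit [TopologicalSpace G] [IsTopologicalGroup G] [CompactSpace G] [MeasurableSpace G] [BorelSpace G] in
/-- For the trivial `1 × 1` representation the Wilson action vanishes identically. [folklore] -/
theorem wilsonAction_trivialRep {d L : ℕ} [NeZero L] (U : GaugeConfig d L G) :
    wilsonAction (1 : G →* Matrix (Fin 1) (Fin 1) ℂ) U = 0 := by
  simp [wilsonAction, Matrix.trace]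

/-- For the trivial representation the torus Wilson measure is product Haar at EVERY coupling. [folklore] -/
theorem wilsonMeasure_trivialRep {d L : ℕ} [NeZero L] (β : ℝ) :
    wilsonMeasure (d := d) (L := L) (1 : G →* Matrix (Fin 1) (Fin 1) ℂ) β =
      wilsonMeasure (d := d) (L := L) (1 : G →* Matrix (Fin 1) (Fin 1) ℂ) 0 := by
  simp [wilsonMeasure, partitionFunction, wilsonWeight, wilsonAction_trivialRep]

/-- **Dropping faithfulness yields no counterexample through the trivial representation**: there the crux's
clause holds at every `β` (the measure is product Haar; `Negative/BetaZeroClause`). Non-faithful representations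
of a SIMPLE `G` factor through the simple quotient `G / ker` (finite central kernel) or are trivial, so
`LatticeRep.injective` is not where an adversary can attack. [folklore] -/
theorem susceptibility_clause_trivialRep (β : ℝ) (A B : YMSpecies G) :
    ∃ χ : ℝ, ∀ S : ℕ,
      ∑ x ∈ box 4 S, |cov[fun U => A.F (torusLift (2 * S + 1) U),
        fun U => B.F (configShift (-x) (torusLift (2 * S + 1) U));
        wilsonMeasure (d := 4) (L := 2 * S + 1) (1 : G →* Matrix (Fin 1) (Fin 1) ℂ) β]| ≤ χ := by
  obtain ⟨χ, hχ⟩ := susceptibility_clause_at_beta_zero (1 : G →* Matrix (Fin 1) (Fin 1) ℂ) A B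
  exact ⟨χ, fun S => by rw [wilsonMeasure_trivialRep]; exact hχ S⟩

end TrivialRep

/-! ### Simplicity: the abelian Coulomb phase (modulo the torus non-summability hypothesis)

No named `Prop`s are introduced (the weakened statement and the `U(1)` hypothesis are written inline), so that
this support file creates no literature debt; the standing disprover's work file names them
`FiniteSusceptibilityWeakCouplingWithoutSimple` and `U1TorusPlaquetteNonSummableD4`. -/

/-- **Simplicity is load-bearing (modulo the torus non-summability of the `U(1)₄` plaquette two-point function).**
HYPOTHESIS `h` — torus/Wilson form of Fröhlich–Spencer 1982 §2.11 ("the two-plaquette correlation cannot have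
summable fall-off"; proved there for the VILLAIN action and the free-boundary state; the Wilson-action Coulomb
phase is the open conjecture `Literature.Barriers.QuantumFields.AbelianMasslessPhaseD4`): for Wilson-action
`U(1)₄` at all large `β` the torus plaquette susceptibility `∑_{x ∈ box 4 S} |Cov_{β,2S+1}(P, P∘τ_x)|`, `P = Re U_p`
the `(0,1)` plaquette at the origin, is unbounded in `S` (free photon: `Cov ~ |x|⁻⁴`, `∑_{|x|≤S} ~ log S`).
CONCLUSION: the crux with `IsCompactSimpleLieGroup G →` deleted is false — instantiate `G = U(1)`, `r = u1Rep`,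
`A = B = plaquetteObservable u1Rep _ 0 1`. [folklore] -/
theorem false_without_simple_of_u1TorusPlaquetteNonSummable
    (h : ∃ β₁ : ℝ, ∀ β : ℝ, β₁ < β → ∀ χ : ℝ, ∃ S : ℕ,
      χ < ∑ x ∈ box 4 S, |cov[fun U => plaquetteObs u1Rep 0 0 1 (torusLift (2 * S + 1) U),
        fun U => plaquetteObs u1Rep 0 0 1 (configShift (-x) (torusLift (2 * S + 1) U));
        wilsonMeasure (d := 4) (L := 2 * S + 1) u1Rep β]|) :
    ¬ ∀ (G : Type) [Group G] [TopologicalSpace G] [IsTopologicalGroup G] [CompactSpace G]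
        [MeasurableSpace G] [BorelSpace G],
        ∀ r : LatticeRep G, ∃ β₀ : ℝ, ∀ β : ℝ, β₀ ≤ β →
          ∀ A B : YMSpecies G, ∃ χ : ℝ, ∀ S : ℕ,
            ∑ x ∈ box 4 S, |cov[fun U => A.F (torusLift (2 * S + 1) U),
              fun U => B.F (configShift (-x) (torusLift (2 * S + 1) U));
              wilsonMeasure (d := 4) (L := 2 * S + 1) r.ρ β]| ≤ χ := by
  intro hW
  obtain ⟨β₁, hβ₁⟩ := h
  obtain ⟨β₀, hβ₀⟩ := hW Circle ⟨1, u1Rep, continuous_u1Rep, u1Rep_injective, u1Rep_mem_unitaryGroup⟩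
  set β : ℝ := max β₀ β₁ + 1 with hβ
  have h0 : β₀ ≤ β := by rw [hβ]; linarith [le_max_left β₀ β₁]
  have h1 : β₁ < β := by rw [hβ]; linarith [le_max_right β₀ β₁]
  set P : YMSpecies Circle := plaquetteObservable (d := 4) u1Rep continuous_u1Rep 0 1 with hP
  obtain ⟨χ, hχ⟩ := hβ₀ β h0 P P
  obtain ⟨S, hS⟩ := hβ₁ β h1 χ
  exact (lt_irrefl χ) (lt_of_lt_of_le hS (by simpa [hP] using hχ S))

/-- The crux implies its simplicity-free weakening restricted to simple groups — i.e. the weakening differs from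
the crux exactly by the groups `circle_not_isCompactSimpleLieGroup` lets in. [folklore] -/
theorem withoutSimple_of_crux_on_simple
    (h : Summit.QuantumFields.YangMills.Theses.FradkinShenkerFlow.FiniteSusceptibilityWeakCoupling)
    (G : Type) [Group G] [TopologicalSpace G] [IsTopologicalGroup G] [CompactSpace G]
    [MeasurableSpace G] [BorelSpace G] (hG : IsSimpleCompactGroup G) (r : LatticeRep G) :
    ∃ β₀ : ℝ, ∀ β : ℝ, β₀ ≤ β →
      ∀ A B : YMSpecies G, ∃ χ : ℝ, ∀ S : ℕ,
        ∑ x ∈ box 4 S, |cov[fun U => A.F (torusLift (2 * S + 1) U),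
          fun U => B.F (configShift (-x) (torusLift (2 * S + 1) U));
          wilsonMeasure (d := 4) (L := 2 * S + 1) r.ρ β]| ≤ χ :=
  h G ⟨hG, ⟨r⟩⟩ r

/-! ### Simplicity is load-bearing: species-agnostic form and the `C`-odd (sine) plaquette instance

(Lead c26 of the crux's line chain, 2026-08-17.) The hypothesis of
`false_without_simple_of_u1TorusPlaquetteNonSummable` is typed with the `C`-EVEN plaquette `Re U_p = cos θ_p`,
which in the `U(1)₄` Coulomb phase couples to `F²` (dimension 4): its connected two-point function is expected to
decay like `|x|⁻⁸`, SUMMABLE in `d = 4`, so that record is very plausibly vacuous (crux `NOTES.md` c5;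
`STRATEGY-CENSUS.md` gen 1 and gen 2 §N10; `TRIAGE-r1-*`). The non-summable observable of the Coulomb phase is
the `C`-ODD one, `Im U_p = sin θ_p ≈ F₀₁` (dimension 2, `Cov ~ |x|⁻⁴`, `∑_{|x| ≤ S} ~ log S`; Fröhlich–Spencer,
CMP 83 (1982) §2.11, for the Villain action and the field strength). Below: (i) the refutation of the
simplicity-free statement from ANY pair of `U(1)` species whose torus susceptibility is unbounded at ARBITRARILY
large `β` (the exact contrapositive shape: `∀ β₁ ∃ β ≥ β₁`, weaker than "at all large `β`"); (ii) the sine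
plaquette `U ↦ Im U_p`, `p` the `(0,1)` plaquette at the origin, IS a `YMSpecies Circle` (cylinder on the four
plaquette edges, gauge invariant because `U(1)` is abelian, bounded by `1`, continuous hence measurable);
(iii) the sine instance of (i). No named `Prop` and no `def` is introduced. [folklore] -/

/-- **Simplicity is load-bearing — species-agnostic form.** If SOME pair `A, B` of bounded gauge-invariant
local observables of `U(1)₄` lattice gauge theory (Wilson action, defining representation, odd tori) has
unbounded torus susceptibility `∑_{x ∈ box 4 S} |Cov_{β,2S+1}(A∘lift, B∘τ_x∘lift)|` at arbitrarily large `β`,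
then the crux with `IsCompactSimpleLieGroup G →` deleted is false: instantiate it at `G = U(1) = Circle`,
`r = u1Rep` (faithful, continuous, unitary) and the pair `(A, B)`. This is the shape a disprover's `U(1)₄`
hypothesis should feed (with a `C`-odd species, e.g. the sine plaquette below, or Lüscher's field tensor
`abelianFieldTensorZd`). [folklore] -/
theorem false_without_simple_of_u1Pair (A B : YMSpecies Circle)
    (h : ∀ β₁ : ℝ, ∃ β : ℝ, β₁ ≤ β ∧ ∀ χ : ℝ, ∃ S : ℕ,
      χ < ∑ x ∈ box 4 S, |cov[fun U => A.F (torusLift (2 * S + 1) U),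
        fun U => B.F (configShift (-x) (torusLift (2 * S + 1) U));
        wilsonMeasure (d := 4) (L := 2 * S + 1) u1Rep β]|) :
    ¬ ∀ (G : Type) [Group G] [TopologicalSpace G] [IsTopologicalGroup G] [CompactSpace G]
        [MeasurableSpace G] [BorelSpace G],
        ∀ r : LatticeRep G, ∃ β₀ : ℝ, ∀ β : ℝ, β₀ ≤ β →
          ∀ A B : YMSpecies G, ∃ χ : ℝ, ∀ S : ℕ,
            ∑ x ∈ box 4 S, |cov[fun U => A.F (torusLift (2 * S + 1) U),
              fun U => B.F (configShift (-x) (torusLift (2 * S + 1) U));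
              wilsonMeasure (d := 4) (L := 2 * S + 1) r.ρ β]| ≤ χ := by
  intro hW
  obtain ⟨β₀, hβ₀⟩ := hW Circle ⟨1, u1Rep, continuous_u1Rep, u1Rep_injective, u1Rep_mem_unitaryGroup⟩
  obtain ⟨β, hβ, hχ'⟩ := h β₀
  obtain ⟨χ, hχ⟩ := hβ₀ β hβ A B
  obtain ⟨S, hS⟩ := hχ' χ
  exact (lt_irrefl χ) (lt_of_lt_of_le hS (hχ S))

/-- **The sine plaquette is a species of `U(1)₄`.** The `C`-odd plaquette observable
`U ↦ Im U_p = Im tr u1Rep(U_p) = sin θ_p`, `p` the `(0,1)` plaquette at the origin of `ℤ⁴`, is a bounded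
gauge-invariant local observable (`YMSpecies Circle = LocalGaugeObservable 4 Circle`): a cylinder function of
the four plaquette edges `originPlaquetteSupport 0 1`, gauge invariant since the `U(1)` plaquette holonomy is
(abelian group: `(U^g)_p = g(0) U_p g(0)⁻¹ = U_p`), bounded by `1` (`|Im z| ≤ |z| = 1` on the circle) and
continuous, hence measurable (countable product of second-countable Borel factors). Stated as an existence so
that no definition is introduced in this support file. [folklore] -/
theorem exists_u1SinePlaquetteSpecies :
    ∃ P : YMSpecies Circle, P.F = fun U => ((plaquetteHolonomyZd U 0 0 1 : Circle) : ℂ).im := by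
  have hcont : Continuous fun U : LGConfig 4 Circle => ((plaquetteHolonomyZd U 0 0 1 : Circle) : ℂ).im := by
    unfold plaquetteHolonomyZd
    fun_prop
  refine ⟨⟨fun U => ((plaquetteHolonomyZd U 0 0 1 : Circle) : ℂ).im, originPlaquetteSupport 0 1,
    ?_, ?_, ⟨1, fun U => ?_⟩, hcont.measurable⟩, rfl⟩
  · intro U V hUV
    have h1 := hUV (((0 : Fin 4 → ℤ), (0 : Fin 4)) : Literature.MathematicalPhysics.QuantumLattice.ZdEdge 4)
      (by simp [originPlaquetteSupport])
    have h2 := hUV (((0 : Fin 4 → ℤ) + Pi.single 0 1, (1 : Fin 4)) :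
      Literature.MathematicalPhysics.QuantumLattice.ZdEdge 4) (by simp [originPlaquetteSupport])
    have h3 := hUV (((0 : Fin 4 → ℤ) + Pi.single 1 1, (0 : Fin 4)) :
      Literature.MathematicalPhysics.QuantumLattice.ZdEdge 4) (by simp [originPlaquetteSupport])
    have h4 := hUV (((0 : Fin 4 → ℤ), (1 : Fin 4)) : Literature.MathematicalPhysics.QuantumLattice.ZdEdge 4)
      (by simp [originPlaquetteSupport])
    simp only [plaquetteHolonomyZd]
    rw [h1, h2, h3, h4]
  · intro g U
    simp only [plaquetteHolonomyZd_gaugeTransformZd, mul_inv_cancel_comm]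
  · exact (Complex.abs_im_le_norm _).trans (le_of_eq (Circle.norm_coe _))

/-- **Simplicity is load-bearing (modulo the torus non-summability of the `U(1)₄` SINE-plaquette two-point
function).** HYPOTHESIS `h` — the torus/Wilson-action form, for the `C`-odd field-strength observable
`Im U_p = sin θ_p`, of Fröhlich–Spencer's theorem (CMP 83 (1982) §2.11, Villain action: the field-strength
two-point function of the Coulomb phase has the free-photon `|x|⁻⁴` fall-off and cannot be summable): at
arbitrarily large `β` the torus susceptibility `∑_{x ∈ box 4 S} |Cov_{β,2S+1}(sin θ_p, sin θ_{p+x})|` is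
unbounded in `S` (`∑_{|x| ≤ S} |x|⁻⁴ ~ log S` in `d = 4`). The Wilson-action statement is open in exactly
this form (`Literature.Barriers.QuantumFields.AbelianMasslessPhaseD4`). CONCLUSION: the crux with
`IsCompactSimpleLieGroup G →` deleted is false. Unlike `false_without_simple_of_u1TorusPlaquetteNonSummable`
(`cos θ_p`, dimension-4 coupling, summable `|x|⁻⁸` tail expected) this record is not expected to be vacuous.
[folklore] -/
theorem false_without_simple_of_u1TorusSinePlaquetteNonSummable
    (h : ∀ β₁ : ℝ, ∃ β : ℝ, β₁ ≤ β ∧ ∀ χ : ℝ, ∃ S : ℕ,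
      χ < ∑ x ∈ box 4 S,
        |cov[fun U => ((plaquetteHolonomyZd (torusLift (2 * S + 1) U) 0 0 1 : Circle) : ℂ).im,
          fun U => ((plaquetteHolonomyZd (configShift (-x) (torusLift (2 * S + 1) U)) 0 0 1 : Circle) : ℂ).im;
          wilsonMeasure (d := 4) (L := 2 * S + 1) u1Rep β]|) :
    ¬ ∀ (G : Type) [Group G] [TopologicalSpace G] [IsTopologicalGroup G] [CompactSpace G]
        [MeasurableSpace G] [BorelSpace G],
        ∀ r : LatticeRep G, ∃ β₀ : ℝ, ∀ β : ℝ, β₀ ≤ β →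
          ∀ A B : YMSpecies G, ∃ χ : ℝ, ∀ S : ℕ,
            ∑ x ∈ box 4 S, |cov[fun U => A.F (torusLift (2 * S + 1) U),
              fun U => B.F (configShift (-x) (torusLift (2 * S + 1) U));
              wilsonMeasure (d := 4) (L := 2 * S + 1) r.ρ β]| ≤ χ := by
  obtain ⟨P, hP⟩ := exists_u1SinePlaquetteSpecies
  refine false_without_simple_of_u1Pair P P ?_
  simpa only [hP] using h

/-- The "at all large `β`" form of the sine hypothesis (the quantifier shape of
`false_without_simple_of_u1TorusPlaquetteNonSummable`) implies the "at arbitrarily large `β`" form used above.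
[folklore] -/
theorem false_without_simple_of_u1TorusSinePlaquetteNonSummable_eventually
    (h : ∃ β₁ : ℝ, ∀ β : ℝ, β₁ < β → ∀ χ : ℝ, ∃ S : ℕ,
      χ < ∑ x ∈ box 4 S,
        |cov[fun U => ((plaquetteHolonomyZd (torusLift (2 * S + 1) U) 0 0 1 : Circle) : ℂ).im,
          fun U => ((plaquetteHolonomyZd (configShift (-x) (torusLift (2 * S + 1) U)) 0 0 1 : Circle) : ℂ).im;
          wilsonMeasure (d := 4) (L := 2 * S + 1) u1Rep β]|) :
    ¬ ∀ (G : Type) [Group G] [TopologicalSpace G] [IsTopologicalGroup G] [CompactSpace G]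
        [MeasurableSpace G] [BorelSpace G],
        ∀ r : LatticeRep G, ∃ β₀ : ℝ, ∀ β : ℝ, β₀ ≤ β →
          ∀ A B : YMSpecies G, ∃ χ : ℝ, ∀ S : ℕ,
            ∑ x ∈ box 4 S, |cov[fun U => A.F (torusLift (2 * S + 1) U),
              fun U => B.F (configShift (-x) (torusLift (2 * S + 1) U));
              wilsonMeasure (d := 4) (L := 2 * S + 1) r.ρ β]| ≤ χ := by
  obtain ⟨β₁, hβ₁⟩ := h
  refine false_without_simple_of_u1TorusSinePlaquetteNonSummable fun β₂ => ?_
  refine ⟨max β₁ β₂ + 1, by linarith [le_max_right β₁ β₂], ?_⟩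
  exact hβ₁ _ (by linarith [le_max_left β₁ β₂])

end Summit.QuantumFields.YangMills.Theorems.FiniteSusceptibilityWeakCoupling.Negative

end
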